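import Summits.QuantumFields.YangMills.Theorems.BalabanUVNodesN22W1RelCentredMembersOfDatum

/-!
# BalabanUVNodes ∕ node N22 = NE9 — THE W1 OBJECT ON THE RELATIVE-DISC CENTRED ROAD (RE-TYPING M1′), MODULE J6: (S-last-T′)ʷ FOR THE MEMBER FAMILY OF THE DATUM FROM LOCATED
# PRIMITIVE INPUTS — the (2.26) weight bound AND the holomorphy in the dilation parameter `b ∈ ball 1 ρ_b` of the window-dilated member of base point `s₀` of a (2.14) term datum,
# kernel-keyed: dag-n10-c g6's `h226_torus_windowDilated_of_primitives` ∕ `differentiableOn_term214_torus_windowDilated_of_primitives` AT THE DATUM (the window-dilated twin of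
# node00-def-W1 g8's W1-8 `norm_TF_le_weight_of_primitives_holo`); and (S-226-T′)ʷ, the history direction at a fixed member, from §5 `…_history_of_primitives` along an older-term curve

Cell `pub-ymgap`, HUMAN RULING D-0062 (Track A), R134 ACCELERATION re-seat `pub-ymgap-dag-n22-c` (strategy s1), generation 7, file J6.  THEOREMS ONLY; imports J5
`…N22W1RelCentredMembersOfDatum` (the member family at lambda level; hence W1-7 `HistoryTermDatum214` and n10-c `B13Term214WindowDilated`) BY NAME.  `--supports` K3⁶
`SpineGivenEndpointR13SepCoPR` (stmt-QuantumFields-20509; dag-lead WORDS-142) as a helper.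

WHY.  J2 ∕ J3 ∕ J4 display, below the run length and for every base point `s₀ ∈ ]0,γ]`, the member statement (S-last-T′)ʷ: `b ↦ mF s₀ k′ Z t b old φ` holomorphic on `ball 1 ρ_b` with
`‖mF s₀ k′ Z t b old φ‖ ≤ weight·e^{a₅|Z|}` there.  For the member family OF THE DATUM under the unscaled-field law (J5: `term214 r (Z∖Z′₀) 𝐃 (core214 (b²·A) (b·Γ) (F214 |P| χᵘ(s₀·)
χᶜᵘ(s₀·) 𝐃 (b²·W_{s₀} + O_{s₀}))) 0 0`, `W_{s₀} := s₀⁻²𝒲(φ, ·, s₀·)`, `O_{s₀} := 𝒪(old, φ, ·, s₀·)`) this is EXACTLY dag-n10-c g6's §4 on the two-scale torus model, read at the datum's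
kernel record (NODE A's `𝒦 Z t`: `A(σ,u)`, `G(σ,u)`, references `C ≻ 0`, `Γ₀`, locations, row fibre bound) the way W1-8 reads the uncentred (2.26) of record
(`norm_TF_le_weight_of_primitives_holo` = `h226_torus_of_primitives_holo_polyτ` at the datum).  THIS FILE is that reading: ONE theorem with the located inputs as binders —
W1-8's list with (i) the coupling `s` replaced by the base point `s₀` (characteristic functions `χᵘ(s₀·)`, `χᶜᵘ(s₀·)`), (ii) the potential's measurability ∕ (2.20) split into the
Wilson remainder `𝒲` (history-free) and the older terms `𝒪` (`hWm`, `hOm`, joint (2.20) `h220U` for `|W_{s₀}| + |O_{s₀}|` on `Π_Y Uτ Y`), (iii) NO `Re A ≻ 0` hypothesis (derived by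
n10-c from the `R₂` form), (iv) ONE extra letter `K_E` (entrywise decay of `C⁻¹`, `hCE`), the ball radius `ρ_b < 1` and the PRIMED letters `K_G′, K_{Cσ}′, θ_Γ′, θ_C′, θ_E′, a′, w′`
dominating n10-c's §2 transports, with the capstone's numeric conditions ∕ `hvol` in the primed letters — and the conclusion = both halves of J2's `hMlast` at the slice
`(k′ := k, Z, t, old, φ, s₀)` for `mF := <J5's member family>`.

WHAT.  §1 ★ `differentiableOn_and_norm_memberOfDatum_le_weight_of_primitives` ((S-last-T′)ʷ = J2's `hMlast` at one slice): under the located inputs,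
`DifferentiableOn ℂ (fun b ↦ m(s₀, b)) (ball 1 ρ_b)` ∧ `∀ b ∈ ball 1 ρ_b, ‖m(s₀, b)‖ ≤ weight L M c Z a t · e^{a₅|Z|}` — one application each of n10-c's two §4 theorems (lists
`sigmaList_spec` ∕ `tauList_spec`, linearity `rfl`, `hfibΛ` = the kernel record's `hfib`, `C ≻ 0` = the record's `hC`).  §2 ★ `differentiableOn_and_norm_memberOfDatum_history_of_primitives`
((S-226-T′)ʷ = the consequent of J2's `hMprop` at one slice): the same inputs with the older terms replaced by a curve `cv : ℂ → OlderTerms` on an open `O ⊆ ℂ` — `𝒪(cv z, φ, Y, s₀·)`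
measurable and `z ↦ 𝒪(cv z, φ, Y, s₀B′)` holomorphic on `O`, the joint (2.20) uniform in `z` — ⇒ `z ↦ m(s₀, b)[old := cv z]` holomorphic on `O` with the (2.26) bound there, for each member
`b ∈ ball 1 ρ_b` (n10-c §5 + §4 pointwise along the curve).

HONEST FRAMING.  Count-neutral kernel-keyed reading of two landed theorems (no estimate proved here); every located input is a HYPOTHESIS (NODE A's kernel letters at the
configuration, Lemma 2's (2.20) for `𝒲`∕`𝒪` on the τ-region, (2.22) for the unscaled-field boxes at `s₀`, the numerics — exactly the binders W1-8 located for the uncentred (2.26),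
plus `K_E`, `ρ_b`, the primed letters); the unscaled-field law itself is NOT used here (J5 uses it for hMagree); nothing of Bałaban's asserted; N22 NOT discharged; one finite
four-torus programme at fixed ε — NOT infinite volume, NOT OS on ℝ⁴, NOT a mass gap, NOT Clay.  0 `sorry`, 0 `def`, standard axioms.

References (TYPES only): [II] = [Balaban1988RG2Cluster] (2.14)–(2.15) p. 15, (2.16)–(2.22) p. 16, (2.23)–(2.26) p. 17, Lemma 2 p. 11; [I] = [Balaban1987RG1] §1 p. 263,
(2.9)–(2.13) pp. 266–268.
-/

noncomputable section

namespace YMDAG.N22.W1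

open Set Metric Matrix
open Literature.MathematicalPhysics.QuantumFieldTheory.Balaban1983to89
open Literature.MathematicalPhysics.QuantumFieldTheory.Balaban1983to89.B13Term214 (term214 core214 F214)
open Literature.MathematicalPhysics.QuantumFieldTheory.Balaban1983to89.B13Term214WindowDilated
  (h226_torus_windowDilated_of_primitives differentiableOn_term214_torus_windowDilated_of_primitives
    differentiableOn_term214_torus_windowDilated_history_of_primitives)
open Literature.MathematicalPhysics.QuantumFieldTheory.Balaban1983to89.TreeLengthTorus (TPt TDom tsys)
open Literature.MathematicalPhysics.QuantumFieldTheory.Balaban1983to89.B13Lemma3TorusTerms (weight)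
open Literature.MathematicalPhysics.QuantumFieldTheory.Balaban1983to89.B13Bound143 (invTau)
open Literature.MathematicalPhysics.QuantumFieldTheory.Balaban1983to89.B9Thm37GlueTorus (tdist1)
open Literature.MathematicalPhysics.QuantumFieldTheory.Balaban1983to89.B5TorusCover (UT)
open Literature.MathematicalPhysics.QuantumFieldTheory.Balaban1983to89.Node00.Sect2 (domSys domCount CPair)
open Literature.MathematicalPhysics.QuantumFieldTheory.Balaban1983to89.Node00.W1

variable {c₀ : B13.Consts} {P : Params} {𝔸 : Type*} {M k L : ℕ} [NeZero L] (𝔇 : TermDatum214 c₀ P 𝔸 M k L)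
  (χu χcu : (Z : (domSys P M (k + 1)).Dom) → (t : TermLabel P M k L) → ((𝔇.𝒦 Z t).Λ → ℝ) → ℝ)
  (𝒲 : (Z : (domSys P M (k + 1)).Dom) → (t : TermLabel P M k L) → CPair P 𝔸 → TDom P.d (L * domCount P M (k + 1)) → ((𝔇.𝒦 Z t).Λ → ℝ) → ℂ)
  (𝒪 : (Z : (domSys P M (k + 1)).Dom) → (t : TermLabel P M k L) → OlderTerms P 𝔸 M k → CPair P 𝔸 → TDom P.d (L * domCount P M (k + 1)) →
    ((𝔇.𝒦 Z t).Λ → ℝ) → ℂ)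

/-! ## §1 (S-last-T′)ʷ: holomorphy in the dilation parameter and the (2.26) weight bound on the ball -/

open Classical in
/-- **(S-last-T′)ʷ FOR THE MEMBER FAMILY OF THE DATUM FROM THE LOCATED PRIMITIVE INPUTS, KERNEL-KEYED** — dag-n10-c g6 `differentiableOn_term214_torus_windowDilated_of_primitives` ∧
`h226_torus_windowDilated_of_primitives` for the window-dilated member of base point `s₀` of the term `(Z, t)` of the datum at `(old, φ)`,
`m(s₀, b) = term214 r (Z∖Z′₀) 𝐃 (core214 (b²·A) (b·Γ) (F214 |P| χᵘ(s₀·) χᶜᵘ(s₀·) 𝐃 (fun Y B′ ↦ b²·(s₀⁻²𝒲(φ,Y,s₀B′)) + 𝒪(old,φ,Y,s₀B′)))) 0 0` (J5's family at lambda level), with the Γ-kernel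
`G(σ) := (𝒦 Z t).G2 σ (uOf φ)`, the references `Γ₀ := (𝒦 Z t).Γ₀`, `C := (𝒦 Z t).C ≻ 0`, the locations and the row fibre bound READ OFF NODE A's kernel record, the list ∕ linearity
binders discharged.  Located inputs (binders): the σ-region `Uσ ⊇` closed `e^{κ₁}`-ball and PER-DOMAIN τ-regions `Uτ Y` (print's radii (2.18)); the Cauchy radius; signs and
measurability of the unscaled-field boxes at `s₀` and their (2.22) shape; measurability of `𝒲(φ,Y,s₀·)`, `𝒪(old,φ,Y,s₀·)` and the JOINT (2.20) shape of `|s₀⁻²𝒲| + |𝒪|` on `Π_Y Uτ Y`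
(Lemma 2 at base point `s₀`); entrywise σ-holomorphy and symmetry of `A(σ,u)`, σ-holomorphy of `G(σ,u)`; the (L17a)∕(L16a) letters at `b = 1` in the torus distance PLUS `K_E`
(entrywise decay of `C⁻¹`); the column fibre bound; the ball radius `ρ_b < 1` and the PRIMED letters dominating n10-c §2's transports (`(1+ρ_b)K_G ≤ K_G′`, `(1−ρ_b)⁻²K_{Cσ} ≤ K_{Cσ}′`,
`θ_Γ + ρ_bK_G ≤ θ_Γ′`, `θ_C + ρ_b(2+ρ_b)(1−ρ_b)⁻²K_{Cσ} ≤ θ_C′`, `θ_E + ρ_b(2+ρ_b)(θ_E + K_E) ≤ θ_E′`, `(1+ρ_b)²a₂₀ ≤ a′`, `(1+ρ_b)²w ≤ w′`); the capstone's numeric conditions, the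
(2.24)–(2.25) smallness and the constant matching `hPa` ∕ `hvol` IN THE PRIMED LETTERS.  NOT assumed: `Re(b²A(σ)) ≻ 0` (n10-c derives it).  Conclusion: `b ↦ m(s₀, b)` is holomorphic
on `ball 1 ρ_b` and `‖m(s₀, b)‖ ≤ weight L M c Z a t · e^{a₅·|Z|}` there — both halves of J2's `hMlast` at this slice.  One application of each tree theorem; no estimate proved here.
[cite: Balaban1988RG2Cluster, (2.14)-(2.15) p.15, (2.16)-(2.22) p.16, (2.23)-(2.26) p.17, Lemma 2 p.11; Balaban1987RG1, §1 p.263, (2.9)-(2.13) pp.266-268] -/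
theorem differentiableOn_and_norm_memberOfDatum_le_weight_of_primitives (c : B13.Consts) (hκ₁ : 1 ≤ c.κ₁) (hα₆ : c.α₆ ≠ 0)
    (Z : (domSys P M (k + 1)).Dom) (t : TermLabel P M k L) (old : OlderTerms P 𝔸 M k) (φ : CPair P 𝔸) (s₀ : ℝ)
    (hpos : ∀ Y : TDom P.d (L * domCount P M (k + 1)), 0 < invTau c ((tsys P.d (L * domCount P M (k + 1))).dj Y))
    (hhalf : ∀ Y : TDom P.d (L * domCount P M (k + 1)), invTau c ((tsys P.d (L * domCount P M (k + 1))).dj Y) ≤ 1 / 2)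
    -- the σ-region (one open set ⊇ the closed e^{κ₁}-ball) and the PER-DOMAIN τ-regions (print's radii (2.18))
    {Uσ : Set ℂ} {Uτ : TDom P.d (L * domCount P M (k + 1)) → Set ℂ} (hUσ : IsOpen Uσ) (hUτ : ∀ Y, IsOpen (Uτ Y))
    (hUexp : closedBall (0 : ℂ) (Real.exp c.κ₁) ⊆ Uσ)
    (hUtau : ∀ Y : TDom P.d (L * domCount P M (k + 1)),
      closedBall (0 : ℂ) ((invTau c ((tsys P.d (L * domCount P M (k + 1))).dj Y))⁻¹) ⊆ Uτ Y)
    (hr : 0 < 𝔇.r) (hr' : 𝔇.r ≤ Real.exp c.κ₁ - 1)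
    (hsubτ : ∀ Y, ∀ x ∈ Set.uIcc (0 : ℝ) 1, closedBall (x : ℂ) 𝔇.r ⊆ Uτ Y)
    -- the unscaled-field boxes at the base point `s₀`: signs, measurability, the (2.22) shape
    (hχ0 : ∀ B, 0 ≤ χu Z t (s₀ • B)) (hχc0 : ∀ B, 0 ≤ χcu Z t (s₀ • B))
    (hχm : Measurable fun B => χu Z t (s₀ • B)) (hχcm : Measurable fun B => χcu Z t (s₀ • B))
    {γ₂ rP a₂₀ w : ℝ} (qP : ((𝔇.𝒦 Z t).Λ → ℝ) → ℝ)
    (h222 : ∀ B, χu Z t (s₀ • B) * χcu Z t (s₀ • B) ≤ Real.exp (-(γ₂ / 2 * rP ^ 2 * (t.2.card : ℕ)) + γ₂ / 2 * qP B)) (hγ₂ : 0 ≤ γ₂)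
    (hqP : ∀ B, qP B ≤ B ⬝ᵥ B) (ha0 : 0 ≤ a₂₀)
    -- the Wilson remainder and the older terms READ IN THE UNSCALED FIELD at `s₀`: measurability and the JOINT (2.20) shape on the open PER-DOMAIN τ-region (Lemma 2)
    (hWm : ∀ Y, Measurable fun B : (𝔇.𝒦 Z t).Λ → ℝ => 𝒲 Z t φ Y (s₀ • B))
    (hOm : ∀ Y, Measurable fun B : (𝔇.𝒦 Z t).Λ → ℝ => 𝒪 Z t old φ Y (s₀ • B))
    (h220U : ∀ τ : TDom P.d (L * domCount P M (k + 1)) → ℂ, (∀ Y, τ Y ∈ Uτ Y) →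
      ∀ B, ∑ Y ∈ t.1, ‖τ Y‖ * (‖(((s₀ : ℝ) : ℂ) ^ 2)⁻¹ * 𝒲 Z t φ Y (s₀ • B)‖ + ‖𝒪 Z t old φ Y (s₀ • B)‖) ≤ a₂₀ / 2 * (B ⬝ᵥ B) + w)
    -- NODE A: entrywise σ-holomorphy of the kernels A(σ,u), G(σ,u) on the OPEN σ-polydisc, symmetry of the precision
    (hAhol : ∀ i j, DifferentiableOn ℂ (fun σ => 𝔇.A Z t φ σ i j) {σ | ∀ j, σ j ∈ Uσ})
    (hGhol : ∀ i j, DifferentiableOn ℂ (fun σ => (𝔇.𝒦 Z t).G2 σ (𝔇.uOf Z t φ) i j) {σ | ∀ j, σ j ∈ Uσ})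
    (hAs : ∀ σ : TPt P.d (domCount P M (k + 1)) → ℂ, (∀ j, σ j ∈ Uσ) → (𝔇.A Z t φ σ).IsSymm)
    -- the column fibre bound (rows: the kernel record's `hfib`)
    (hfibN : ∀ x : UT 𝔇.Nf, (Finset.univ.filter fun j => (𝔇.𝒦 Z t).locN j = x).card ≤ (𝔇.𝒦 Z t).m)
    -- rates and the letters AT b = 1 (+ K_E)
    {kap kap' kap'' θ θE θΓ θC KG KΓ KCs K₀ KE : ℝ} (hkap'' : 0 < kap'') (h1 : kap'' < kap') (h2 : kap' < kap)
    (hθE : 0 ≤ θE) (hθΓ : 0 ≤ θΓ) (hθC : 0 ≤ θC) (hKG : 0 ≤ KG) (hKΓ : 0 ≤ KΓ) (hKCs : 0 ≤ KCs) (hK₀ : 0 ≤ K₀) (hKE : 0 ≤ KE)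
    -- (L17a) for the kernels at the configuration, in the torus distance, and the entrywise decay of C⁻¹
    (hG : ∀ σ : TPt P.d (domCount P M (k + 1)) → ℂ, (∀ j, σ j ∈ Uσ) →
      ∀ b j, ‖(𝔇.𝒦 Z t).G2 σ (𝔇.uOf Z t φ) b j‖ ≤ KG * Real.exp (-(kap * tdist1 𝔇.Nf ((𝔇.𝒦 Z t).locΛ b) ((𝔇.𝒦 Z t).locN j))))
    (hΓ₀ : ∀ b j, ‖(𝔇.𝒦 Z t).Γ₀ b j‖ ≤ KΓ * Real.exp (-(kap * tdist1 𝔇.Nf ((𝔇.𝒦 Z t).locΛ b) ((𝔇.𝒦 Z t).locN j))))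
    (hCs : ∀ σ : TPt P.d (domCount P M (k + 1)) → ℂ, (∀ j, σ j ∈ Uσ) →
      ∀ b b', ‖(𝔇.A Z t φ σ)⁻¹ b b'‖ ≤ KCs * Real.exp (-(kap * tdist1 𝔇.Nf ((𝔇.𝒦 Z t).locΛ b) ((𝔇.𝒦 Z t).locΛ b'))))
    (hC216 : ∀ b b', ‖(𝔇.𝒦 Z t).C b b'‖ ≤ K₀ * Real.exp (-(kap * tdist1 𝔇.Nf ((𝔇.𝒦 Z t).locΛ b) ((𝔇.𝒦 Z t).locΛ b'))))
    (hCE : ∀ b b', ‖((𝔇.𝒦 Z t).C⁻¹.map (algebraMap ℝ ℂ)) b b'‖ ≤ KE * Real.exp (-(kap * tdist1 𝔇.Nf ((𝔇.𝒦 Z t).locΛ b) ((𝔇.𝒦 Z t).locΛ b'))))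
    -- (L16a) for the kernels at the configuration, in the torus distance
    (hdΓ : ∀ σ : TPt P.d (domCount P M (k + 1)) → ℂ, (∀ j, σ j ∈ Uσ) →
      ∀ b j, ‖((𝔇.𝒦 Z t).G2 σ (𝔇.uOf Z t φ) - (𝔇.𝒦 Z t).Γ₀.map (algebraMap ℝ ℂ)) b j‖
        ≤ θΓ * Real.exp (-(kap * tdist1 𝔇.Nf ((𝔇.𝒦 Z t).locΛ b) ((𝔇.𝒦 Z t).locN j))))
    (hdC : ∀ σ : TPt P.d (domCount P M (k + 1)) → ℂ, (∀ j, σ j ∈ Uσ) →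
      ∀ b b', ‖((𝔇.A Z t φ σ)⁻¹ - (𝔇.𝒦 Z t).C.map (algebraMap ℝ ℂ)) b b'‖
        ≤ θC * Real.exp (-(kap * tdist1 𝔇.Nf ((𝔇.𝒦 Z t).locΛ b) ((𝔇.𝒦 Z t).locΛ b'))))
    (hdE : ∀ σ : TPt P.d (domCount P M (k + 1)) → ℂ, (∀ j, σ j ∈ Uσ) →
      ∀ b b', ‖(𝔇.A Z t φ σ - (𝔇.𝒦 Z t).C⁻¹.map (algebraMap ℝ ℂ)) b b'‖
        ≤ θE * Real.exp (-(kap * tdist1 𝔇.Nf ((𝔇.𝒦 Z t).locΛ b) ((𝔇.𝒦 Z t).locΛ b'))))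
    -- the radius of the ball in `b` and the PRIMED letters dominating n10-c §2's transports
    {ρb KG' KCs' θΓ' θC' θE' a' w' : ℝ} (hρb1 : ρb < 1)
    (hKG' : (1 + ρb) * KG ≤ KG') (hKCs' : ((1 - ρb) ^ 2)⁻¹ * KCs ≤ KCs')
    (hθΓ' : θΓ + ρb * KG ≤ θΓ') (hθC' : θC + ρb * (2 + ρb) * ((1 - ρb) ^ 2)⁻¹ * KCs ≤ θC')
    (hθE' : θE + ρb * (2 + ρb) * (θE + KE) ≤ θE')
    (ha' : (1 + ρb) ^ 2 * a₂₀ ≤ a') (hw' : (1 + ρb) ^ 2 * w ≤ w')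
    -- the capstone's numeric conditions in the primed letters
    (hθEle : θE' ≤ θ) (hθΓle : θΓ' ≤ θ)
    (hθR1le : ((𝔇.𝒦 Z t).m * (1 + 2 / (kap - kap')) ^ 𝔇.ν) * ((𝔇.𝒦 Z t).m * (1 + 2 / (kap' - kap'')) ^ 𝔇.ν)
      * (θΓ' * KCs' * KG' + KΓ * θC' * KG' + KΓ * K₀ * θΓ') ≤ θ)
    (hsmallKθ : K₀ * ((𝔇.𝒦 Z t).m * (1 + 2 / kap) ^ 𝔇.ν) * (θ * ((𝔇.𝒦 Z t).m * (1 + 2 / kap'') ^ 𝔇.ν)) < 1)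
    -- the (2.24)–(2.25) smallness in the primed letters
    {cE g : ℝ} (hc0 : 0 ≤ cE) (hc : ∀ i, (𝔇.𝒦 Z t).hC.1.eigenvalues i ≤ cE)
    (hαc : (2 * (θ * ((𝔇.𝒦 Z t).m * (1 + 2 / kap'') ^ 𝔇.ν)) + (γ₂ + a')) * cE ≤ 1 / 2) (hg : 0 ≤ g)
    (hΓq : ∀ X : (𝔇.𝒦 Z t).Λ ⊕ (𝔇.𝒦 Z t).C₀ → ℝ,
      ((𝔇.𝒦 Z t).Γ₀ *ᵥ X) ⬝ᵥ ((𝔇.𝒦 Z t).C *ᵥ ((𝔇.𝒦 Z t).Γ₀ *ᵥ X)) ≤ g * (X ⬝ᵥ X))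
    (hsmall : (2 * (θ * ((𝔇.𝒦 Z t).m * (1 + 2 / kap'') ^ 𝔇.ν)) + (γ₂ + a')) * (1 + 2 * cE * g) ≤ 1 / 2)
    -- constant matching, p. 17, in the primed letters
    {a a₅ : ℝ} (hPa : a ≤ γ₂ * rP ^ 2)
    (hvol : 2 * (K₀ * ((𝔇.𝒦 Z t).m * (1 + 2 / kap) ^ 𝔇.ν) * (θ * ((𝔇.𝒦 Z t).m * (1 + 2 / kap'') ^ 𝔇.ν))
              * (1 + (1 - K₀ * ((𝔇.𝒦 Z t).m * (1 + 2 / kap) ^ 𝔇.ν) * (θ * ((𝔇.𝒦 Z t).m * (1 + 2 / kap'') ^ 𝔇.ν)))⁻¹) / 2)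
          * (Fintype.card (𝔇.𝒦 Z t).Λ : ℝ)
        + w' + (2 * (θ * ((𝔇.𝒦 Z t).m * (1 + 2 / kap'') ^ 𝔇.ν)) + (γ₂ + a')) * cE * (Fintype.card (𝔇.𝒦 Z t).Λ : ℝ)
        + (2 * (θ * ((𝔇.𝒦 Z t).m * (1 + 2 / kap'') ^ 𝔇.ν)) + (γ₂ + a')) * (1 + 2 * cE * g)
          * (Fintype.card ((𝔇.𝒦 Z t).Λ ⊕ (𝔇.𝒦 Z t).C₀) : ℝ)
        ≤ a₅ * ((Z.1).card : ℝ)) :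
    DifferentiableOn ℂ (fun b : ℂ => term214 𝔇.r (sigmaList L Z t) (tauList P M k L t)
        (core214 (fun σ => b ^ 2 • 𝔇.A Z t φ σ) (fun σ X => b • 𝔇.Gam Z t φ σ X)
          (F214 t.2.card (fun B => χu Z t (s₀ • B)) (fun B => χcu Z t (s₀ • B)) t.1
            (fun Y B => b ^ 2 * ((((s₀ : ℝ) : ℂ) ^ 2)⁻¹ * 𝒲 Z t φ Y (s₀ • B)) + 𝒪 Z t old φ Y (s₀ • B)))) 0 0) (ball (1 : ℂ) ρb) ∧
    ∀ b ∈ ball (1 : ℂ) ρb, ‖term214 𝔇.r (sigmaList L Z t) (tauList P M k L t)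
        (core214 (fun σ => b ^ 2 • 𝔇.A Z t φ σ) (fun σ X => b • 𝔇.Gam Z t φ σ X)
          (F214 t.2.card (fun B => χu Z t (s₀ • B)) (fun B => χcu Z t (s₀ • B)) t.1
            (fun Y B => b ^ 2 * ((((s₀ : ℝ) : ℂ) ^ 2)⁻¹ * 𝒲 Z t φ Y (s₀ • B)) + 𝒪 Z t old φ Y (s₀ • B)))) 0 0‖ ≤
      weight L M c Z a t * Real.exp (a₅ * ((Z.1).card : ℝ)) := by
  -- measurability of the scaled Wilson remainder
  have hWm' : ∀ Y, Measurable fun B : (𝔇.𝒦 Z t).Λ → ℝ => (((s₀ : ℝ) : ℂ) ^ 2)⁻¹ * 𝒲 Z t φ Y (s₀ • B) := fun Y => (hWm Y).const_mul _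
  refine ⟨?_, ?_⟩
  · exact differentiableOn_term214_torus_windowDilated_of_primitives c hUσ hUτ hUexp hr hr' hsubτ (sigmaList_spec Z t).1 (tauList_spec t).1
      (𝔇.A Z t φ) (𝔇.Gam Z t φ) t.2.card (fun B => χu Z t (s₀ • B)) (fun B => χcu Z t (s₀ • B)) hχ0 hχc0 t.1
      (fun Y B => (((s₀ : ℝ) : ℂ) ^ 2)⁻¹ * 𝒲 Z t φ Y (s₀ • B)) (fun Y B => 𝒪 Z t old φ Y (s₀ • B))
      (𝔇.𝒦 Z t).hC (𝔇.𝒦 Z t).Γ₀ hAhol hχm hχcm hWm' hOm hAs (fun σ => (𝔇.𝒦 Z t).G2 σ (𝔇.uOf Z t φ)) hGhol (fun _ _ _ => rfl)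
      qP h222 hγ₂ hqP ha0 h220U (𝔇.𝒦 Z t).locΛ (𝔇.𝒦 Z t).locN (𝔇.𝒦 Z t).hfib hfibN
      hkap'' h1 h2 hθE hθΓ hθC hKG hKΓ hKCs hK₀ hKE hG hΓ₀ hCs hC216 hCE hdΓ hdC hdE hρb1 hKG' hKCs' hθΓ' hθC' hθE' ha' hw'
      hθEle hθΓle hθR1le hsmallKθ hc0 hc hαc hΓq hsmall
  · exact h226_torus_windowDilated_of_primitives c hκ₁ hα₆ Z t hpos hhalf hUσ hUτ hUexp hUtau hr hr' hsubτ
      (sigmaList L Z t) (sigmaList_spec Z t) (tauList P M k L t) (tauList_spec t)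
      (𝔇.A Z t φ) (𝔇.Gam Z t φ) (fun B => χu Z t (s₀ • B)) (fun B => χcu Z t (s₀ • B)) hχ0 hχc0 t.1
      (fun Y B => (((s₀ : ℝ) : ℂ) ^ 2)⁻¹ * 𝒲 Z t φ Y (s₀ • B)) (fun Y B => 𝒪 Z t old φ Y (s₀ • B))
      (𝔇.𝒦 Z t).hC (𝔇.𝒦 Z t).Γ₀ hAhol hχm hχcm hWm' hOm hAs (fun σ => (𝔇.𝒦 Z t).G2 σ (𝔇.uOf Z t φ)) hGhol (fun _ _ _ => rfl)
      qP h222 hγ₂ hqP ha0 h220U (𝔇.𝒦 Z t).locΛ (𝔇.𝒦 Z t).locN (𝔇.𝒦 Z t).hfib hfibN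
      hkap'' h1 h2 hθE hθΓ hθC hKG hKΓ hKCs hK₀ hKE hG hΓ₀ hCs hC216 hCE hdΓ hdC hdE hρb1 hKG' hKCs' hθΓ' hθC' hθE' ha' hw'
      hθEle hθΓle hθR1le hsmallKθ hc0 hc hαc hg hΓq hsmall hPa hvol

/-! ## §2 (S-226-T′)ʷ: the history direction at a fixed member, from the same located inputs along an older-term curve -/

open Classical in
/-- **(S-226-T′)ʷ FOR THE MEMBER FAMILY OF THE DATUM FROM THE LOCATED PRIMITIVE INPUTS ALONG AN OLDER-TERM CURVE, KERNEL-KEYED** — dag-n10-c g6 §5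
`differentiableOn_term214_torus_windowDilated_history_of_primitives` (parameter space `ℂ`, open set `O`, the parameter entering the OLDER TERMS ONLY: [II] (1.41), [I] (2.12)–(2.13)) ∧
§4 `h226_torus_windowDilated_of_primitives` pointwise along the curve, for the window-dilated member of base point `s₀` at ONE member `b ∈ ball 1 ρ_b` with the older terms replaced by
a curve `cv : ℂ → OlderTerms`: the located inputs of §1 with the older-terms data now ALONG THE CURVE — measurability of `𝒪(cv z, φ, Y, s₀·)` for `z ∈ O`, holomorphy of
`z ↦ 𝒪(cv z, φ, Y, s₀B′)` on `O` for every `(Y, B′)` (the potentials' holomorphy in the history — a producer's law of Lemma 2's potentials, displayed), and the joint (2.20) shape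
uniform in `z ∈ O`; the Wilson remainder `𝒲` is history-free.  Conclusion: `z ↦ m(s₀, b)[old := cv z]` is holomorphic on `O` with `‖m(s₀, b)[old := cv z]‖ ≤ weight L M c Z a t ·
e^{a₅|Z|}` there — the consequent of J2's `hMprop` at this slice (its antecedent, the curve's holomorphy ∕ (1.18)-bounds on the space tables, is what a producer turns into `hOd` ∕
`h220U`).  One application of each tree theorem; no estimate proved here.
[cite: Balaban1988RG2Cluster, (1.41) p.11, (2.14)-(2.15) p.15, (2.16)-(2.22) p.16, (2.23)-(2.26) p.17; Balaban1987RG1, (2.12)-(2.13) p.268] -/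
theorem differentiableOn_and_norm_memberOfDatum_history_of_primitives (c : B13.Consts) (hκ₁ : 1 ≤ c.κ₁) (hα₆ : c.α₆ ≠ 0)
    (Z : (domSys P M (k + 1)).Dom) (t : TermLabel P M k L) (φ : CPair P 𝔸) (s₀ : ℝ)
    -- the older-term curve along an open set of the parameter plane ([II] (1.41): the history enters through 𝒪 only)
    {O : Set ℂ} (hO : IsOpen O) (cv : ℂ → OlderTerms P 𝔸 M k)
    (hpos : ∀ Y : TDom P.d (L * domCount P M (k + 1)), 0 < invTau c ((tsys P.d (L * domCount P M (k + 1))).dj Y))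
    (hhalf : ∀ Y : TDom P.d (L * domCount P M (k + 1)), invTau c ((tsys P.d (L * domCount P M (k + 1))).dj Y) ≤ 1 / 2)
    -- the σ-region (one open set ⊇ the closed e^{κ₁}-ball) and the PER-DOMAIN τ-regions (print's radii (2.18))
    {Uσ : Set ℂ} {Uτ : TDom P.d (L * domCount P M (k + 1)) → Set ℂ} (hUσ : IsOpen Uσ) (hUτ : ∀ Y, IsOpen (Uτ Y))
    (hUexp : closedBall (0 : ℂ) (Real.exp c.κ₁) ⊆ Uσ)
    (hUtau : ∀ Y : TDom P.d (L * domCount P M (k + 1)),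
      closedBall (0 : ℂ) ((invTau c ((tsys P.d (L * domCount P M (k + 1))).dj Y))⁻¹) ⊆ Uτ Y)
    (hr : 0 < 𝔇.r) (hr' : 𝔇.r ≤ Real.exp c.κ₁ - 1)
    (hsubτ : ∀ Y, ∀ x ∈ Set.uIcc (0 : ℝ) 1, closedBall (x : ℂ) 𝔇.r ⊆ Uτ Y)
    -- the unscaled-field boxes at the base point `s₀`: signs, measurability, the (2.22) shape
    (hχ0 : ∀ B, 0 ≤ χu Z t (s₀ • B)) (hχc0 : ∀ B, 0 ≤ χcu Z t (s₀ • B))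
    (hχm : Measurable fun B => χu Z t (s₀ • B)) (hχcm : Measurable fun B => χcu Z t (s₀ • B))
    {γ₂ rP a₂₀ w : ℝ} (qP : ((𝔇.𝒦 Z t).Λ → ℝ) → ℝ)
    (h222 : ∀ B, χu Z t (s₀ • B) * χcu Z t (s₀ • B) ≤ Real.exp (-(γ₂ / 2 * rP ^ 2 * (t.2.card : ℕ)) + γ₂ / 2 * qP B)) (hγ₂ : 0 ≤ γ₂)
    (hqP : ∀ B, qP B ≤ B ⬝ᵥ B) (ha0 : 0 ≤ a₂₀)
    -- the Wilson remainder and the older terms READ IN THE UNSCALED FIELD at `s₀`: measurability and the JOINT (2.20) shape on the open PER-DOMAIN τ-region (Lemma 2)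
    (hWm : ∀ Y, Measurable fun B : (𝔇.𝒦 Z t).Λ → ℝ => 𝒲 Z t φ Y (s₀ • B))
    (hOm : ∀ z ∈ O, ∀ Y, Measurable fun B : (𝔇.𝒦 Z t).Λ → ℝ => 𝒪 Z t (cv z) φ Y (s₀ • B))
    (hOd : ∀ (Y) (B : (𝔇.𝒦 Z t).Λ → ℝ), DifferentiableOn ℂ (fun z => 𝒪 Z t (cv z) φ Y (s₀ • B)) O)
    (h220U : ∀ z ∈ O, ∀ τ : TDom P.d (L * domCount P M (k + 1)) → ℂ, (∀ Y, τ Y ∈ Uτ Y) →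
      ∀ B, ∑ Y ∈ t.1, ‖τ Y‖ * (‖(((s₀ : ℝ) : ℂ) ^ 2)⁻¹ * 𝒲 Z t φ Y (s₀ • B)‖ + ‖𝒪 Z t (cv z) φ Y (s₀ • B)‖) ≤ a₂₀ / 2 * (B ⬝ᵥ B) + w)
    -- NODE A: entrywise σ-holomorphy of the kernels A(σ,u), G(σ,u) on the OPEN σ-polydisc, symmetry of the precision
    (hAhol : ∀ i j, DifferentiableOn ℂ (fun σ => 𝔇.A Z t φ σ i j) {σ | ∀ j, σ j ∈ Uσ})
    (hGhol : ∀ i j, DifferentiableOn ℂ (fun σ => (𝔇.𝒦 Z t).G2 σ (𝔇.uOf Z t φ) i j) {σ | ∀ j, σ j ∈ Uσ})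
    (hAs : ∀ σ : TPt P.d (domCount P M (k + 1)) → ℂ, (∀ j, σ j ∈ Uσ) → (𝔇.A Z t φ σ).IsSymm)
    -- the column fibre bound (rows: the kernel record's `hfib`)
    (hfibN : ∀ x : UT 𝔇.Nf, (Finset.univ.filter fun j => (𝔇.𝒦 Z t).locN j = x).card ≤ (𝔇.𝒦 Z t).m)
    -- rates and the letters AT b = 1 (+ K_E)
    {kap kap' kap'' θ θE θΓ θC KG KΓ KCs K₀ KE : ℝ} (hkap'' : 0 < kap'') (h1 : kap'' < kap') (h2 : kap' < kap)
    (hθE : 0 ≤ θE) (hθΓ : 0 ≤ θΓ) (hθC : 0 ≤ θC) (hKG : 0 ≤ KG) (hKΓ : 0 ≤ KΓ) (hKCs : 0 ≤ KCs) (hK₀ : 0 ≤ K₀) (hKE : 0 ≤ KE)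
    -- (L17a) for the kernels at the configuration, in the torus distance, and the entrywise decay of C⁻¹
    (hG : ∀ σ : TPt P.d (domCount P M (k + 1)) → ℂ, (∀ j, σ j ∈ Uσ) →
      ∀ b j, ‖(𝔇.𝒦 Z t).G2 σ (𝔇.uOf Z t φ) b j‖ ≤ KG * Real.exp (-(kap * tdist1 𝔇.Nf ((𝔇.𝒦 Z t).locΛ b) ((𝔇.𝒦 Z t).locN j))))
    (hΓ₀ : ∀ b j, ‖(𝔇.𝒦 Z t).Γ₀ b j‖ ≤ KΓ * Real.exp (-(kap * tdist1 𝔇.Nf ((𝔇.𝒦 Z t).locΛ b) ((𝔇.𝒦 Z t).locN j))))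
    (hCs : ∀ σ : TPt P.d (domCount P M (k + 1)) → ℂ, (∀ j, σ j ∈ Uσ) →
      ∀ b b', ‖(𝔇.A Z t φ σ)⁻¹ b b'‖ ≤ KCs * Real.exp (-(kap * tdist1 𝔇.Nf ((𝔇.𝒦 Z t).locΛ b) ((𝔇.𝒦 Z t).locΛ b'))))
    (hC216 : ∀ b b', ‖(𝔇.𝒦 Z t).C b b'‖ ≤ K₀ * Real.exp (-(kap * tdist1 𝔇.Nf ((𝔇.𝒦 Z t).locΛ b) ((𝔇.𝒦 Z t).locΛ b'))))
    (hCE : ∀ b b', ‖((𝔇.𝒦 Z t).C⁻¹.map (algebraMap ℝ ℂ)) b b'‖ ≤ KE * Real.exp (-(kap * tdist1 𝔇.Nf ((𝔇.𝒦 Z t).locΛ b) ((𝔇.𝒦 Z t).locΛ b'))))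
    -- (L16a) for the kernels at the configuration, in the torus distance
    (hdΓ : ∀ σ : TPt P.d (domCount P M (k + 1)) → ℂ, (∀ j, σ j ∈ Uσ) →
      ∀ b j, ‖((𝔇.𝒦 Z t).G2 σ (𝔇.uOf Z t φ) - (𝔇.𝒦 Z t).Γ₀.map (algebraMap ℝ ℂ)) b j‖
        ≤ θΓ * Real.exp (-(kap * tdist1 𝔇.Nf ((𝔇.𝒦 Z t).locΛ b) ((𝔇.𝒦 Z t).locN j))))
    (hdC : ∀ σ : TPt P.d (domCount P M (k + 1)) → ℂ, (∀ j, σ j ∈ Uσ) →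
      ∀ b b', ‖((𝔇.A Z t φ σ)⁻¹ - (𝔇.𝒦 Z t).C.map (algebraMap ℝ ℂ)) b b'‖
        ≤ θC * Real.exp (-(kap * tdist1 𝔇.Nf ((𝔇.𝒦 Z t).locΛ b) ((𝔇.𝒦 Z t).locΛ b'))))
    (hdE : ∀ σ : TPt P.d (domCount P M (k + 1)) → ℂ, (∀ j, σ j ∈ Uσ) →
      ∀ b b', ‖(𝔇.A Z t φ σ - (𝔇.𝒦 Z t).C⁻¹.map (algebraMap ℝ ℂ)) b b'‖
        ≤ θE * Real.exp (-(kap * tdist1 𝔇.Nf ((𝔇.𝒦 Z t).locΛ b) ((𝔇.𝒦 Z t).locΛ b'))))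
    -- the radius of the ball in `b` and the PRIMED letters dominating n10-c §2's transports
    {ρb KG' KCs' θΓ' θC' θE' a' w' : ℝ} (hρb1 : ρb < 1)
    (hKG' : (1 + ρb) * KG ≤ KG') (hKCs' : ((1 - ρb) ^ 2)⁻¹ * KCs ≤ KCs')
    (hθΓ' : θΓ + ρb * KG ≤ θΓ') (hθC' : θC + ρb * (2 + ρb) * ((1 - ρb) ^ 2)⁻¹ * KCs ≤ θC')
    (hθE' : θE + ρb * (2 + ρb) * (θE + KE) ≤ θE')
    (ha' : (1 + ρb) ^ 2 * a₂₀ ≤ a') (hw' : (1 + ρb) ^ 2 * w ≤ w')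
    -- the capstone's numeric conditions in the primed letters
    (hθEle : θE' ≤ θ) (hθΓle : θΓ' ≤ θ)
    (hθR1le : ((𝔇.𝒦 Z t).m * (1 + 2 / (kap - kap')) ^ 𝔇.ν) * ((𝔇.𝒦 Z t).m * (1 + 2 / (kap' - kap'')) ^ 𝔇.ν)
      * (θΓ' * KCs' * KG' + KΓ * θC' * KG' + KΓ * K₀ * θΓ') ≤ θ)
    (hsmallKθ : K₀ * ((𝔇.𝒦 Z t).m * (1 + 2 / kap) ^ 𝔇.ν) * (θ * ((𝔇.𝒦 Z t).m * (1 + 2 / kap'') ^ 𝔇.ν)) < 1)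
    -- the (2.24)–(2.25) smallness in the primed letters
    {cE g : ℝ} (hc0 : 0 ≤ cE) (hc : ∀ i, (𝔇.𝒦 Z t).hC.1.eigenvalues i ≤ cE)
    (hαc : (2 * (θ * ((𝔇.𝒦 Z t).m * (1 + 2 / kap'') ^ 𝔇.ν)) + (γ₂ + a')) * cE ≤ 1 / 2) (hg : 0 ≤ g)
    (hΓq : ∀ X : (𝔇.𝒦 Z t).Λ ⊕ (𝔇.𝒦 Z t).C₀ → ℝ,
      ((𝔇.𝒦 Z t).Γ₀ *ᵥ X) ⬝ᵥ ((𝔇.𝒦 Z t).C *ᵥ ((𝔇.𝒦 Z t).Γ₀ *ᵥ X)) ≤ g * (X ⬝ᵥ X))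
    (hsmall : (2 * (θ * ((𝔇.𝒦 Z t).m * (1 + 2 / kap'') ^ 𝔇.ν)) + (γ₂ + a')) * (1 + 2 * cE * g) ≤ 1 / 2)
    -- constant matching, p. 17, in the primed letters
    {a a₅ : ℝ} (hPa : a ≤ γ₂ * rP ^ 2)
    (hvol : 2 * (K₀ * ((𝔇.𝒦 Z t).m * (1 + 2 / kap) ^ 𝔇.ν) * (θ * ((𝔇.𝒦 Z t).m * (1 + 2 / kap'') ^ 𝔇.ν))
              * (1 + (1 - K₀ * ((𝔇.𝒦 Z t).m * (1 + 2 / kap) ^ 𝔇.ν) * (θ * ((𝔇.𝒦 Z t).m * (1 + 2 / kap'') ^ 𝔇.ν)))⁻¹) / 2)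
          * (Fintype.card (𝔇.𝒦 Z t).Λ : ℝ)
        + w' + (2 * (θ * ((𝔇.𝒦 Z t).m * (1 + 2 / kap'') ^ 𝔇.ν)) + (γ₂ + a')) * cE * (Fintype.card (𝔇.𝒦 Z t).Λ : ℝ)
        + (2 * (θ * ((𝔇.𝒦 Z t).m * (1 + 2 / kap'') ^ 𝔇.ν)) + (γ₂ + a')) * (1 + 2 * cE * g)
          * (Fintype.card ((𝔇.𝒦 Z t).Λ ⊕ (𝔇.𝒦 Z t).C₀) : ℝ)
        ≤ a₅ * ((Z.1).card : ℝ))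
    -- ONE member of the ball
    {b : ℂ} (hb : b ∈ ball (1 : ℂ) ρb) :
    DifferentiableOn ℂ (fun z : ℂ => term214 𝔇.r (sigmaList L Z t) (tauList P M k L t)
        (core214 (fun σ => b ^ 2 • 𝔇.A Z t φ σ) (fun σ X => b • 𝔇.Gam Z t φ σ X)
          (F214 t.2.card (fun B => χu Z t (s₀ • B)) (fun B => χcu Z t (s₀ • B)) t.1
            (fun Y B => b ^ 2 * ((((s₀ : ℝ) : ℂ) ^ 2)⁻¹ * 𝒲 Z t φ Y (s₀ • B)) + 𝒪 Z t (cv z) φ Y (s₀ • B)))) 0 0) O ∧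
    ∀ z ∈ O, ‖term214 𝔇.r (sigmaList L Z t) (tauList P M k L t)
        (core214 (fun σ => b ^ 2 • 𝔇.A Z t φ σ) (fun σ X => b • 𝔇.Gam Z t φ σ X)
          (F214 t.2.card (fun B => χu Z t (s₀ • B)) (fun B => χcu Z t (s₀ • B)) t.1
            (fun Y B => b ^ 2 * ((((s₀ : ℝ) : ℂ) ^ 2)⁻¹ * 𝒲 Z t φ Y (s₀ • B)) + 𝒪 Z t (cv z) φ Y (s₀ • B)))) 0 0‖ ≤
      weight L M c Z a t * Real.exp (a₅ * ((Z.1).card : ℝ)) := by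
  -- measurability of the scaled Wilson remainder
  have hWm' : ∀ Y, Measurable fun B : (𝔇.𝒦 Z t).Λ → ℝ => (((s₀ : ℝ) : ℂ) ^ 2)⁻¹ * 𝒲 Z t φ Y (s₀ • B) := fun Y => (hWm Y).const_mul _
  refine ⟨?_, fun z hz => ?_⟩
  · -- n10-c §5 at the datum: the parameter enters the older terms only
    exact differentiableOn_term214_torus_windowDilated_history_of_primitives (P := ℂ) (Wp := O) c hO hUσ hUτ hUexp hr hr' hsubτ
      (sigmaList_spec Z t).1 (tauList_spec t).1 (𝔇.A Z t φ) (𝔇.Gam Z t φ) t.2.card (fun B => χu Z t (s₀ • B)) (fun B => χcu Z t (s₀ • B)) hχ0 hχc0 t.1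
      (fun Y B => (((s₀ : ℝ) : ℂ) ^ 2)⁻¹ * 𝒲 Z t φ Y (s₀ • B)) (fun z Y B => 𝒪 Z t (cv z) φ Y (s₀ • B))
      (𝔇.𝒦 Z t).hC (𝔇.𝒦 Z t).Γ₀ hAhol hχm hχcm hWm' hOm hOd hAs (fun σ => (𝔇.𝒦 Z t).G2 σ (𝔇.uOf Z t φ)) hGhol (fun _ _ _ => rfl)
      qP h222 hγ₂ hqP ha0 h220U (𝔇.𝒦 Z t).locΛ (𝔇.𝒦 Z t).locN (𝔇.𝒦 Z t).hfib hfibN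
      hkap'' h1 h2 hθE hθΓ hθC hKG hKΓ hKCs hK₀ hKE hG hΓ₀ hCs hC216 hCE hdΓ hdC hdE hρb1 hKG' hKCs' hθΓ' hθC' hθE' ha' hw'
      hθEle hθΓle hθR1le hsmallKθ hc0 hc hαc hΓq hsmall hb
  · -- n10-c §4's (2.26) at the older terms `cv z`, at the member `b`
    exact h226_torus_windowDilated_of_primitives c hκ₁ hα₆ Z t hpos hhalf hUσ hUτ hUexp hUtau hr hr' hsubτ
      (sigmaList L Z t) (sigmaList_spec Z t) (tauList P M k L t) (tauList_spec t)
      (𝔇.A Z t φ) (𝔇.Gam Z t φ) (fun B => χu Z t (s₀ • B)) (fun B => χcu Z t (s₀ • B)) hχ0 hχc0 t.1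
      (fun Y B => (((s₀ : ℝ) : ℂ) ^ 2)⁻¹ * 𝒲 Z t φ Y (s₀ • B)) (fun Y B => 𝒪 Z t (cv z) φ Y (s₀ • B))
      (𝔇.𝒦 Z t).hC (𝔇.𝒦 Z t).Γ₀ hAhol hχm hχcm hWm' (hOm z hz) hAs (fun σ => (𝔇.𝒦 Z t).G2 σ (𝔇.uOf Z t φ)) hGhol (fun _ _ _ => rfl)
      qP h222 hγ₂ hqP ha0 (h220U z hz) (𝔇.𝒦 Z t).locΛ (𝔇.𝒦 Z t).locN (𝔇.𝒦 Z t).hfib hfibN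
      hkap'' h1 h2 hθE hθΓ hθC hKG hKΓ hKCs hK₀ hKE hG hΓ₀ hCs hC216 hCE hdΓ hdC hdE hρb1 hKG' hKCs' hθΓ' hθC' hθE' ha' hw'
      hθEle hθΓle hθR1le hsmallKθ hc0 hc hαc hg hΓq hsmall hPa hvol b hb

end YMDAG.N22.W1

end
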